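import Summits.Ventures.CertifiedArithmetic.LowPrec.SRPythagorasMeanMonotone
import HarnessLib

/-!
# CXVIII — Positive association of limited-randomness SR accumulation trees (tree Chebyshev inequality)

HONEST FRAMING: certified error envelopes and provably optimal rounding/accumulation schemes for
low-precision formats under stated cost models; every table by two implementations; no hardware or
vendor claims.

For EVERY finite value set `F`, EVERY admissible rounding-probability rule `q` that is MONOTONE on
`[0,1]` (IEEE P3109 `StochasticA` with any number `N` of random bits: CXII
`probAwayA_monotoneOn`; exact SR; every `SR_ε` of §4f), every summand sequence and every `n`, the law
of the accumulated value `ŝₙ` is POSITIVELY ASSOCIATED along monotone observables: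

* `stepQ_chebyshev` — one rounding: `E[f·g] ≥ E[f]·E[g]` for nondecreasing `f, g` (any `q` with
  values in `[0,1]`; the two-point Chebyshev sum inequality `p(1−p)(f u − f d)(g u − g d) ≥ 0`);
* `accExpQ_chebyshev` — the whole tree: `E[f(ŝₙ)·g(ŝₙ)] ≥ E[f(ŝₙ)]·E[g(ŝₙ)]` for nondecreasing
  `f, g` (induction on the FIRST step with CXII's monotone mean map `accExpQ_mono_arg` feeding the
  two-point inequality at the root, and `stepQ_mono_leaves` for the induction hypothesis);
* `accExpQ_chebyshev_antitone` — nondecreasing `f`, nonincreasing `g`: `E[f·g] ≤ E[f]·E[g]`;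
* `accExpQ_sq_ge` — Jensen for the square as the case `f = g = (· − a)`;
* `accExpQ_cov_id_nonneg` — the accumulated value is nonnegatively correlated with every
  nondecreasing function of itself: `E[(ŝₙ − a)·h(ŝₙ)] ≥ E[ŝₙ − a]·E[h(ŝₙ)]`;
* `stochasticA_chebyshev` — the `StochasticA` instance, every `N`.

WHY (analysis note pub-lowprec-sr/SR-PYTHAGORAS-N3-ACCOUNTING-g22.md, §2 (R2), §4 (ii)): by CX the
Pythagorean law for `3 ≤ N < J` bits is the single inequality `−2E[Mₙ·Y] ≤ Σ E[VS_k] + spare`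
coupling the accumulated exact-SR noise with the total truncation; every usable lower bound on a
correlation `E[(position)·(monotone function of position)]` on these trees is an instance of the
present inequality (the truncation is monotone along `E`-congruent states in coarse cells, CXIV
`resid_le_resid_mul`).  This file is the general tool; it claims nothing about the open law.

References: the two-point case is the Chebyshev sum inequality; positive association of monotone
Markov chains started from a point is classical (Harris/FKG type) — no source states it for
limited-randomness SR outcome trees ([ConnollyHighamMary2021] exact SR moments;
[ElararEtAl2025] `SR_{p,r}` first-order analysis; IEEE P3109 interim report, modes).
-/

namespace Summit.Ventures.CertifiedArithmetic.LowPrec.SR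

open Literature.ComputerArithmetic.ConnollyHighamMary2021
open Finset

variable {K : Type*} [Field K] [LinearOrder K] [IsStrictOrderedRing K]

namespace LimitedBits

/-! ### 1. One rounding: the two-point Chebyshev inequality -/

/-- **One-step Chebyshev**: for a rule with values in `[0,1]` and nondecreasing `f, g`,
`E[f]·E[g] ≤ E[f·g]` over the two SR candidates of `c`. -/
theorem stepQ_chebyshev (F : Finset K) {q : K → K}
    (hq01 : ∀ η, 0 ≤ η → η ≤ 1 → 0 ≤ q η ∧ q η ≤ 1) (c : K) {f g : K → K}
    (hf : Monotone f) (hg : Monotone g) :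
    stepQ F q c f * stepQ F q c g ≤ stepQ F q c (fun z => f z * g z) := by
  obtain ⟨hp0, hp1⟩ := pUpQ_mem F hq01 c
  have hfm : f (dn F c) ≤ f (up F c) := hf (dn_le_up F c)
  have hgm : g (dn F c) ≤ g (up F c) := hg (dn_le_up F c)
  unfold stepQ
  set p := pUpQ F q c
  have key : p * (f (up F c) * g (up F c)) + (1 - p) * (f (dn F c) * g (dn F c)) -
      (p * f (up F c) + (1 - p) * f (dn F c)) * (p * g (up F c) + (1 - p) * g (dn F c)) =
      p * (1 - p) * ((f (up F c) - f (dn F c)) * (g (up F c) - g (dn F c))) := by ring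
  have hnn : 0 ≤ p * (1 - p) * ((f (up F c) - f (dn F c)) * (g (up F c) - g (dn F c))) :=
    mul_nonneg (mul_nonneg hp0 (sub_nonneg.mpr hp1))
      (mul_nonneg (sub_nonneg.mpr hfm) (sub_nonneg.mpr hgm))
  linarith

/-- One-step Chebyshev, opposite monotonicity: nondecreasing `f`, nonincreasing `g` ⇒
`E[f·g] ≤ E[f]·E[g]`. -/
theorem stepQ_chebyshev_antitone (F : Finset K) {q : K → K}
    (hq01 : ∀ η, 0 ≤ η → η ≤ 1 → 0 ≤ q η ∧ q η ≤ 1) (c : K) {f g : K → K}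
    (hf : Monotone f) (hg : Antitone g) :
    stepQ F q c (fun z => f z * g z) ≤ stepQ F q c f * stepQ F q c g := by
  have h := stepQ_chebyshev F hq01 c hf (hg.neg)
  have e1 : stepQ F q c (fun z => f z * -g z) = -stepQ F q c (fun z => f z * g z) := by
    unfold stepQ; ring
  have e2 : stepQ F q c (fun z => -g z) = -stepQ F q c g := by unfold stepQ; ring
  rw [e1, e2] at h
  linarith

/-! ### 2. The whole accumulation tree -/

/-- **Tree Chebyshev inequality (positive association)**: for a nonempty value set, an admissible
rule MONOTONE on `[0,1]`, nondecreasing `f, g`, every summand sequence `x`, every `n` and every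
start `s`: `E[f(ŝₙ)]·E[g(ŝₙ)] ≤ E[f(ŝₙ)·g(ŝₙ)]`. -/
theorem accExpQ_chebyshev {F : Finset K} (hF : F.Nonempty) {q : K → K}
    (hq01 : ∀ η, 0 ≤ η → η ≤ 1 → 0 ≤ q η ∧ q η ≤ 1) (hq : MonotoneOn q (Set.Icc 0 1)) :
    ∀ (x : ℕ → K) (n : ℕ) {f g : K → K}, Monotone f → Monotone g → ∀ s : K,
      accExpQ F q x n f s * accExpQ F q x n g s ≤ accExpQ F q x n (fun z => f z * g z) s := by
  intro x n
  induction n generalizing x with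
  | zero => intro f g _ _ s; simp [accExpQ]
  | succ n ih =>
    intro f g hf hg s
    simp only [accExpQ]
    -- the two subtree mean maps are nondecreasing in the start value (CXII)
    have hF' : Monotone (accExpQ F q (fun i => x (i + 1)) n f) := accExpQ_mono_arg hF hq01 hq _ n hf
    have hG' : Monotone (accExpQ F q (fun i => x (i + 1)) n g) := accExpQ_mono_arg hF hq01 hq _ n hg
    -- root: two-point Chebyshev on the subtree means; leaves: the induction hypothesis
    refine (stepQ_chebyshev F hq01 (s + x 0) hF' hG').trans ?_
    exact stepQ_mono_leaves F hq01 (s + x 0) (ih _ hf hg _) (ih _ hf hg _)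

/-- Tree Chebyshev, opposite monotonicity: nondecreasing `f`, nonincreasing `g` ⇒
`E[f(ŝₙ)·g(ŝₙ)] ≤ E[f(ŝₙ)]·E[g(ŝₙ)]`. -/
theorem accExpQ_chebyshev_antitone {F : Finset K} (hF : F.Nonempty) {q : K → K}
    (hq01 : ∀ η, 0 ≤ η → η ≤ 1 → 0 ≤ q η ∧ q η ≤ 1) (hq : MonotoneOn q (Set.Icc 0 1))
    (x : ℕ → K) (n : ℕ) {f g : K → K} (hf : Monotone f) (hg : Antitone g) (s : K) :
    accExpQ F q x n (fun z => f z * g z) s ≤ accExpQ F q x n f s * accExpQ F q x n g s := by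
  have h := accExpQ_chebyshev hF hq01 hq x n hf hg.neg s
  have e1 : accExpQ F q x n (fun z => f z * -g z) s = -accExpQ F q x n (fun z => f z * g z) s := by
    have := accExpQ_lin F q x n (-1) 0 (fun z => f z * g z) (fun _ => (0 : K)) s
    simpa using this
  have e2 : accExpQ F q x n (fun z => -g z) s = -accExpQ F q x n g s := by
    have := accExpQ_lin F q x n (-1) 0 g (fun _ => (0 : K)) s
    simpa using this
  rw [e1, e2] at h
  linarith

/-! ### 3. Corollaries -/

/-- **Jensen for the square** as the diagonal case: `(E[ŝₙ − a])² ≤ E[(ŝₙ − a)²]`. -/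
theorem accExpQ_sq_ge {F : Finset K} (hF : F.Nonempty) {q : K → K}
    (hq01 : ∀ η, 0 ≤ η → η ≤ 1 → 0 ≤ q η ∧ q η ≤ 1) (hq : MonotoneOn q (Set.Icc 0 1))
    (x : ℕ → K) (n : ℕ) (a s : K) :
    accExpQ F q x n (fun z => z - a) s ^ 2 ≤ accExpQ F q x n (fun z => (z - a) ^ 2) s := by
  have hm : Monotone (fun z : K => z - a) := fun _ _ h => by linarith
  have h := accExpQ_chebyshev hF hq01 hq x n hm hm s
  have e : (fun z : K => (z - a) * (z - a)) = fun z => (z - a) ^ 2 := by funext z; ring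
  rw [e] at h
  nlinarith [h]

/-- **The accumulated value is nonnegatively correlated with every nondecreasing function of
itself**: `E[ŝₙ − a]·E[h(ŝₙ)] ≤ E[(ŝₙ − a)·h(ŝₙ)]` (e.g. `a = sₙ`: the signed error against any
nondecreasing statistic of the final state). -/
theorem accExpQ_cov_id_nonneg {F : Finset K} (hF : F.Nonempty) {q : K → K}
    (hq01 : ∀ η, 0 ≤ η → η ≤ 1 → 0 ≤ q η ∧ q η ≤ 1) (hq : MonotoneOn q (Set.Icc 0 1))
    (x : ℕ → K) (n : ℕ) (a : K) {h : K → K} (hh : Monotone h) (s : K) :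
    accExpQ F q x n (fun z => z - a) s * accExpQ F q x n h s ≤
      accExpQ F q x n (fun z => (z - a) * h z) s :=
  accExpQ_chebyshev hF hq01 hq x n (fun _ _ h => by linarith) hh s

section StochasticA
variable [FloorRing K]

/-- **`StochasticA` with any number `N` of random bits**: positive association of the
accumulation tree along nondecreasing observables, every value set, summands, `n`, start. -/
theorem stochasticA_chebyshev {F : Finset K} (hF : F.Nonempty) (N : ℕ) (x : ℕ → K) (n : ℕ)
    {f g : K → K} (hf : Monotone f) (hg : Monotone g) (s : K) :
    accExpQ F (probAwayA N) x n f s * accExpQ F (probAwayA N) x n g s ≤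
      accExpQ F (probAwayA N) x n (fun z => f z * g z) s :=
  accExpQ_chebyshev hF (probAwayA_mem N) (probAwayA_monotoneOn N) x n hf hg s

/-- `StochasticA`, opposite monotonicity. -/
theorem stochasticA_chebyshev_antitone {F : Finset K} (hF : F.Nonempty) (N : ℕ) (x : ℕ → K)
    (n : ℕ) {f g : K → K} (hf : Monotone f) (hg : Antitone g) (s : K) :
    accExpQ F (probAwayA N) x n (fun z => f z * g z) s ≤
      accExpQ F (probAwayA N) x n f s * accExpQ F (probAwayA N) x n g s :=
  accExpQ_chebyshev_antitone hF (probAwayA_mem N) (probAwayA_monotoneOn N) x n hf hg s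

end StochasticA

end LimitedBits

/-! ### 4. Kernel instance (E3M2): the inequality is strict on a genuine tree and an equality on a
deterministic one -/

namespace Formats

open LimitedBits

/-- E3M2, `StochasticA` with two bits, start `2`, summands `57/8, −53/8, 113/16` (the tree xNB of
CX): with `f = g = id`, `E[ŝ₃]² < E[ŝ₃²]` — strict, the tree branches. -/
theorem e3m2_xNB_chebyshev_id :
    accExpQ e3m2 (probAwayA 2) (seqL [57 / 8, -53 / 8, 113 / 16]) 3 (fun z => z) 2 ^ 2 <
      accExpQ e3m2 (probAwayA 2) (seqL [57 / 8, -53 / 8, 113 / 16]) 3 (fun z => z * z) 2 := by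
  decide +kernel

end Formats

end Summit.Ventures.CertifiedArithmetic.LowPrec.SR
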